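import Summits.BirchSwinnertonDyer.BirchSwinnertonDyer.Theorems.AdditiveBranchIMCGordTwoRankOneWanAnyRoadStepL
import Summits.BirchSwinnertonDyer.BirchSwinnertonDyer.Theorems.AdditiveBranchIMCGordTwoRankOneTwistRowClosedHL
import HarnessLib

/-!
# The dyadic Wan road, file 5/5 `ClosedHL`: THE KERNELS — the rank-one tame road over a road field of ANY parity, and the dyadic Wan sub-row
# from the field supply `FieldOneTwo` (= the statement of the [L] stub `stub_dyadicWanChain` with `PrintedFactsTame` / `DyadicWanRoadRow` opened)

* `missingLowerBoundAt_rankOne_of_tameRoadFieldAny_tenFacts` — the field-explicit kernel (`K`, `Wd` as binders; ANY Wan prime): p761092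
  `TwistRowRankOneClosedHL.missingLowerBoundAt_rankOne_of_twistAny_tenFacts` l.150–196 re-run over `TameRoadFieldAny`;
* `missingLowerBoundAt_rankOne_of_dyadicWan_tenFacts (hF : FieldOneTwo) …` — the dyadic kernel (supply from `FieldOneTwo`, `Wd` := the globally minimal
  model of `E^{(d_K)}`), verbatim e18 §4;
* `missingLowerBoundAt_rankOne_of_dyadicWan_tenFacts'` — the same with `hF` DISCHARGED by the tree theorem `WanAnyRoad.fieldOneTwo_holds`
  (`TwistRootNumberDyadic.fieldOneTwo`, p777009 ∘ p776858): the dyadic Wan sub-row in analytic rank one CLOSED MODULO the ten printed theorems.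

PROVENANCE: this is the pen's CHECKED, SORRY-FREE port `Cruxes/GordTwoRankOne/WanAnyRoadPort.lean` v1 (planner bsd-addord-plan g44, E354, crux commit
8edfc766c5d5, sha256 8cb68225fc3c8710, lean check rc 0 / 0 sorries), landed Theorems-side by seat prover-bsd-addord-stub-1-g0 per the recipe e18 §5 (director-bsd
(587)(B)); namespace `…Cruxes.GordTwoRankOne.WanTameBdpRoad.Port` ↦ `…Theorems.WanAnyRoad`, vocabulary from `AdditiveBranchIMCGordTwoRankOneWanAnyRoadDefs`, split
into ≤ 400-line files (`…WanAnyRoad{Field,Flat,Socket,StepL,ClosedHL}`); proofs byte-identical otherwise. BSD is proved for no curve by any of this.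
References: [JetchevSkinnerWan2017] §7.4.1 (arXiv:1512.06894 p. 30); [CastellaLiuWan2022] Thm. 8.2.1 (1), §6.1; [Hsieh2014] Thm. B; [LiuZhangZhang2018]
Thm. 1.5.1/1.5.3; [CaiShuTian2014] Thm. 1.1; [HoffsteinLuo1997] Theorem (§1); [SkinnerUrban2014] Thm. 3.6.4.
-/

set_option autoImplicit false
set_option linter.dupNamespace false

noncomputable section

open scoped Classical
open NumberField IsDedekindDomain IsDedekindDomain.HeightOneSpectrum Rat.HeightOneSpectrum
open WeierstrassCurve Literature.NumberTheory.EllipticCurves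
open Literature.NumberTheory.EllipticCurves.Rank1Residual
open Literature.NumberTheory.QuadraticFields
open Summit.BirchSwinnertonDyer.Rank1Residual
open Summit.BirchSwinnertonDyer.Rank1Residual.Additive
open Summit.BirchSwinnertonDyer.BirchSwinnertonDyer.Theorems
open ThreeFieldRoadSupply

namespace Summit.BirchSwinnertonDyer.BirchSwinnertonDyer.Theorems.WanAnyRoad

/-! ### §9 THE KERNELS: the rank-one tame road over a road field of any parity; the dyadic Wan sub-row from `FieldOneTwo` -/

section Kernel

open NumberField IsDedekindDomain IsDedekindDomain.HeightOneSpectrum Rat.HeightOneSpectrum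
open WeierstrassCurve Literature.NumberTheory.EllipticCurves
  Literature.NumberTheory.EllipticCurves.ModularForms
  Literature.NumberTheory.EllipticCurves.Rank1Residual
  Literature.NumberTheory.EllipticCurves.Rank1Residual.Typed
open Field
open ThreeFieldRoadSupply TwistRowRankOneClosedHL

/-- **THE RANK-ONE TAME ROAD OVER A ROAD FIELD WHOSE WAN PRIME HAS ANY PARITY, FROM THE TEN PRINTED THEOREMS — FIELD-EXPLICIT FORM**:
for `E` of analytic rank `1` on cell (G-ord, `e = 2`) (`p ≥ 5`, `ρ̄` onto, additive primes of quadratic-twist type: `htt` at the odd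
ones, `h2tt` at `2`), a road field `K` (`TameRoadFieldAny W p K`) and a globally minimal model `Wd` of `E^{(d_K)}` of analytic rank `0`
on the same cell with `ρ̄` onto: `MissingLowerBoundAt W p`. Proof = p761092's chain over §6–§8 (♭-inclusion ⟹ socket ⟹ Step L ⟹ joint
lower) and the twist's upper half `ClassX4Gord.missingUpperBoundAt_rankZero_of_katoHalf`. The ten printed binders are p761092's.
[cite: JetchevSkinnerWan2017, §7.4.1 (arXiv:1512.06894 p. 30)] [cite: CastellaLiuWan2022, Thm. 8.2.1 (1)] [cite: Kato2004Asterisque, Thm. 17.4]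
[cite: Delbourgo1998, Prop. 4] [cite: Hsieh2014, Thm. B (Doc. Math. 19 p. 713)] [cite: LiuZhangZhang2018, Thm 1.5.1 and Thm 1.5.3] -/
theorem missingLowerBoundAt_rankOne_of_tameRoadFieldAny_tenFacts
    (hWu : Wuthrich2014.kato_halfEigenCharIdeal_dvd_cyclotomicPrime_of_surjective)
    (hDel : Delbourgo1998.prop4_rankZero_pow_dvd_constantCoeff)
    (hGZK : rank_eq_analyticRank_of_analyticRank_le_one) (hmodP : nonempty_modularParametrizationData)
    (hHL : HoffsteinLuo1997_exists_twist_L_one_ne_zero) (hCSTrc : CaiShuTian2014.thm11_ringClassChar)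
    (hB : Hsieh2014.thmB_exists_isHsiehLFunction_coeff_norm_eq_one_unrPeriod_ramifiedSteinberg)
    (hLZZ : LiuZhangZhang2018.thm151_thm153_modularCurve_heegnerVector_additive_ramifiedSteinberg)
    (h821 : CastellaLiuWan2022.thm821_XGr₂_charIdeal_mul_le_awayFromCyc_semistableTwistDyadic)
    (h61 : CastellaLiuWan2022.sec61_exists_isCastellaLiuWanLFunction₂_semistableTwistDyadic)
    (W : WeierstrassCurve ℚ) [W.IsElliptic] [W.IsGloballyMinimal] (p : ℕ) [Fact p.Prime]
    (hr : W.analyticRank = 1) (hcell : N10.CellGordTwo W p) (hp5 : 5 ≤ p) (hsurj : Surj W p)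
    (h2tt : ∀ r : Nat.Primes, (r : ℕ) = 2 → W.HasAdditiveReductionAt ((primesEquiv (R := ℤ)).symm r) →
      ∃ t : ℤ, (t = -1 ∨ t = 2 ∨ t = -2) ∧ ¬ (W.quadraticTwist (t : ℚ)).HasAdditiveReductionAt ((primesEquiv (R := ℤ)).symm r))
    (htt : ∀ r : Nat.Primes, (r : ℕ) ≠ 2 → W.HasAdditiveReductionAt ((primesEquiv (R := ℤ)).symm r) →
      ¬ (W.quadraticTwist (((-1 : ℤ) ^ ((r : ℕ) / 2) * r : ℤ) : ℚ)).HasAdditiveReductionAt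
        ((primesEquiv (R := ℤ)).symm r))
    (K : Type) [Field K] [NumberField K] (hTRF : TameRoadFieldAny W p K)
    (Wd : WeierstrassCurve ℚ) [Wd.IsElliptic] [Wd.IsGloballyMinimal]
    (htw : ∃ C : VariableChange ℚ, C • W.quadraticTwist (NumberField.discr K : ℚ) = Wd)
    (hrd : Wd.analyticRank = 0) (hcelld : N10.CellGordTwo Wd p) (hsurjd : Surj Wd p) :
    MissingLowerBoundAt W p := by
  -- the derived facts
  have hnf : exists_isNewformOf := exists_isNewformOf_of_nonempty_modularParametrizationData hmodP
  have hmod : hasEntireLFunction_rat := WeierstrassCurve.hasEntireLFunction_rat_of_exists_isNewformOf hnf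
  have hGZ73 : GrossZagier1986_thm_I_7_3 :=
    ExplicitGrossZagierTrivialChar.GrossZagier1986_thm_I_7_3_of_thm11_ringClassChar hmodP hHL hCSTrc
  have hCST : CaiShuTian2014.thm11_trivialChar :=
    ExplicitGrossZagierTrivialChar.thm11_trivialChar_of_thm11_ringClassChar hCSTrc hmod
  have hsum : W.analyticRank + Wd.analyticRank = 1 := by omega
  -- the road: ♭-inclusion ⟹ branch socket ⟹ Step L ⟹ joint lower half (§6–§8)
  have hIncl := flatInclusion_wanAny hmodP hB h821 h61 W p K hcell hp5 hsurj h2tt htt hTRF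
  have hsock := branchSocketAt_of_flatInclusionUnit_rankFree_wanAny hB hLZZ hCST hGZK hmod W p K hp5 hcell.2.1 hsurj
    hTRF hIncl
  have hstepL := tameStepLAt_of_branchSocketAt_wanAny hCST hGZK hmod W p K Wd hp5 hcell.2.1 hTRF htw hsum hsock
  have hJ : JointLowerBoundAt W Wd p :=
    jointLowerBoundAt_of_tameRoadFieldAny_of_stepL hCST hGZK hmod hmodP hGZ73 W p K Wd hp5 hTRF htw hsum hstepL
  -- the twist's upper half from the tree (rank `0`, `ρ̄` onto, `p ≥ 5`)
  have hX4 : ClassX4Gord Wd p :=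
    ⟨⟨hcelld.1, hcelld.2.1, hasIrreducibleModPGaloisRep_of_hasSurjectiveModNGaloisRep Wd p hsurjd⟩, hcelld.2.2.1⟩
  have hed : semistabilityIndex Wd p = 2 := hcelld.2.2.2
  have hram3 : p = 3 → Ram Wd p := fun h3 ↦ absurd h3 (by omega)
  exact missingLowerBoundAt_of_joint_of_upper hJ
    (ClassX4Gord.missingUpperBoundAt_rankZero_of_katoHalf hWu hDel hGZK hmod hmodP hX4 hed hrd hsurjd hram3)

/-- **THE DYADIC WAN SUB-ROW IN ANALYTIC RANK ONE FROM THE FIELD SUPPLY `FieldOneTwo` AND THE TEN PRINTED THEOREMS** — the statement of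
the skeleton's `stub_dyadicWanChain` (v23) with `PrintedFactsTame` opened into p761092's ten names and `DyadicWanRoadRow` opened into its
binders (`5 ≤ p`, `Surj`, `htt`, `WanPrimeAny W p 2`): `MissingLowerBoundAt W p`. Proof: the supply gives `K` with `|d_K| > 4`, `2 ∣ d_K`, the
odd primes of `N_E` split, `p` split, `L(E^{(d_K)}, 1) ≠ 0`; `tameRoadFieldAny_two` makes it a road field with Wan prime `2`; the rank-zero
twist `Wd` lies on the cell (`cellGordTwo_tameTwist_discr`, read (R3)) with `ρ̄` onto; `h2tt` is vacuous (`h2tt_of_mult_two`); then the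
field-explicit kernel. [cite: HoffsteinLuo1997, Theorem (§1, pp. 435–436)] [cite: JetchevSkinnerWan2017, §7.4.1 (arXiv:1512.06894 p. 30)]
[cite: CastellaLiuWan2022, Thm. 8.2.1 (1)] -/
theorem missingLowerBoundAt_rankOne_of_dyadicWan_tenFacts (hF : FieldOneTwo)
    (hWu : Wuthrich2014.kato_halfEigenCharIdeal_dvd_cyclotomicPrime_of_surjective)
    (hDel : Delbourgo1998.prop4_rankZero_pow_dvd_constantCoeff)
    (hGZK : rank_eq_analyticRank_of_analyticRank_le_one) (hmodP : nonempty_modularParametrizationData)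
    (hHL : HoffsteinLuo1997_exists_twist_L_one_ne_zero) (hCSTrc : CaiShuTian2014.thm11_ringClassChar)
    (hB : Hsieh2014.thmB_exists_isHsiehLFunction_coeff_norm_eq_one_unrPeriod_ramifiedSteinberg)
    (hLZZ : LiuZhangZhang2018.thm151_thm153_modularCurve_heegnerVector_additive_ramifiedSteinberg)
    (h821 : CastellaLiuWan2022.thm821_XGr₂_charIdeal_mul_le_awayFromCyc_semistableTwistDyadic)
    (h61 : CastellaLiuWan2022.sec61_exists_isCastellaLiuWanLFunction₂_semistableTwistDyadic)
    (W : WeierstrassCurve ℚ) [W.IsElliptic] [W.IsGloballyMinimal] (p : ℕ) [Fact p.Prime]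
    (hr : W.analyticRank = 1) (hcell : N10.CellGordTwo W p) (hp5 : 5 ≤ p) (hsurj : Surj W p)
    (htt : ∀ r : Nat.Primes, (r : ℕ) ≠ 2 → W.HasAdditiveReductionAt ((primesEquiv (R := ℤ)).symm r) →
      ¬ (W.quadraticTwist (((-1 : ℤ) ^ ((r : ℕ) / 2) * r : ℤ) : ℚ)).HasAdditiveReductionAt
        ((primesEquiv (R := ℤ)).symm r))
    (hWan : WanPrimeAny W p 2) : MissingLowerBoundAt W p := by
  -- the derived facts
  have hnf : exists_isNewformOf := exists_isNewformOf_of_nonempty_modularParametrizationData hmodP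
  have hmod : hasEntireLFunction_rat := WeierstrassCurve.hasEntireLFunction_rat_of_exists_isNewformOf hnf
  have hpar : ∀ X : WeierstrassCurve ℚ, even_analyticRank_iff_rootNumber_eq_one X :=
    fun X ↦ even_analyticRank_iff_rootNumber_eq_one_of_exists_isNewformOf X hnf
  have hw : W.rootNumber = -1 := (rootNumber_of_analyticRank_le_one W hpar).2 hr
  have hp2 : p ≠ 2 := by omega
  -- the supply: the road field `K` with Wan prime `2` (`B := 4`) and the rank-zero twist `Wd`
  obtain ⟨K, iF, iN, hK, hB4, h2d, hsplit, hpK, hL⟩ := hF W hnf hHL htt hw hWan.2.1 hWan.2.2.1 p Fact.out hp2 4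
  have hTRF : TameRoadFieldAny W p K := tameRoadFieldAny_two hK hB4 h2d hsplit hpK hWan
  have hD0 : (NumberField.discr K : ℚ) ≠ 0 := by exact_mod_cast NumberField.discr_ne_zero K
  obtain ⟨Wd, iWd, iWdm, Cd', hCd'⟩ := exists_isGloballyMinimal_smul_eq_quadraticTwist W hD0
  have hWd : Cd'⁻¹ • W.quadraticTwist (NumberField.discr K : ℚ) = Wd := by rw [← hCd', inv_smul_smul]
  have hrd : Wd.analyticRank = 0 := analyticRank_eq_zero_tameTwist W K hmod Cd'⁻¹ hWd hL
  have hcelld : N10.CellGordTwo Wd p := cellGordTwo_tameTwist_discr W p K hp5 hK hpK Cd'⁻¹ hWd hcell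
  have hsurjd : Surj Wd p := surj_tameTwist W p K Cd'⁻¹ hWd hsurj
  -- `h2tt` is vacuous: `E` is multiplicative at `2`
  exact missingLowerBoundAt_rankOne_of_tameRoadFieldAny_tenFacts hWu hDel hGZK hmodP hHL hCSTrc hB hLZZ h821 h61 W p hr hcell
    hp5 hsurj (h2tt_of_mult_two W hWan.2.1) htt K hTRF Wd ⟨Cd'⁻¹, hWd⟩ hrd hcelld hsurjd

/-- **THE DYADIC WAN SUB-ROW IN ANALYTIC RANK ONE, CLOSED MODULO THE TEN PRINTED THEOREMS** — `missingLowerBoundAt_rankOne_of_dyadicWan_tenFacts` with its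
field-supply hypothesis `hF : FieldOneTwo` DISCHARGED by the tree theorem `fieldOneTwo_holds` (`TwistRootNumberDyadic.fieldOneTwo`: the dyadic root-number
engine p777009 ∘ the Hoffstein–Luo field supply p776858). For every `E / ℚ` (globally minimal `W`) of analytic rank `1`, every prime `p ≥ 5` of cell
(G-ord, `e = 2`) with `ρ̄_{E,p}` onto, odd additive primes of quadratic-twist type and `2` a Wan prime (`WanPrimeAny W p 2`): `ord_p #Ш(E)_an ≤ ord_p #Ш(E)`,
given the ten printed theorems by name. [cite: JetchevSkinnerWan2017, §7.4.1 (arXiv:1512.06894 p. 30)] [cite: CastellaLiuWan2022, Thm. 8.2.1 (1)]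
[cite: Hsieh2014, Thm. B] [cite: HoffsteinLuo1997, Theorem (§1, pp. 435–436)] -/
theorem missingLowerBoundAt_rankOne_of_dyadicWan_tenFacts'
    (hWu : Wuthrich2014.kato_halfEigenCharIdeal_dvd_cyclotomicPrime_of_surjective)
    (hDel : Delbourgo1998.prop4_rankZero_pow_dvd_constantCoeff)
    (hGZK : rank_eq_analyticRank_of_analyticRank_le_one) (hmodP : nonempty_modularParametrizationData)
    (hHL : HoffsteinLuo1997_exists_twist_L_one_ne_zero) (hCSTrc : CaiShuTian2014.thm11_ringClassChar)
    (hB : Hsieh2014.thmB_exists_isHsiehLFunction_coeff_norm_eq_one_unrPeriod_ramifiedSteinberg)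
    (hLZZ : LiuZhangZhang2018.thm151_thm153_modularCurve_heegnerVector_additive_ramifiedSteinberg)
    (h821 : CastellaLiuWan2022.thm821_XGr₂_charIdeal_mul_le_awayFromCyc_semistableTwistDyadic)
    (h61 : CastellaLiuWan2022.sec61_exists_isCastellaLiuWanLFunction₂_semistableTwistDyadic)
    (W : WeierstrassCurve ℚ) [W.IsElliptic] [W.IsGloballyMinimal] (p : ℕ) [Fact p.Prime]
    (hr : W.analyticRank = 1) (hcell : N10.CellGordTwo W p) (hp5 : 5 ≤ p) (hsurj : Surj W p)
    (htt : ∀ r : Nat.Primes, (r : ℕ) ≠ 2 → W.HasAdditiveReductionAt ((primesEquiv (R := ℤ)).symm r) →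
      ¬ (W.quadraticTwist (((-1 : ℤ) ^ ((r : ℕ) / 2) * r : ℤ) : ℚ)).HasAdditiveReductionAt
        ((primesEquiv (R := ℤ)).symm r))
    (hWan : WanPrimeAny W p 2) : MissingLowerBoundAt W p :=
  missingLowerBoundAt_rankOne_of_dyadicWan_tenFacts fieldOneTwo_holds hWu hDel hGZK hmodP hHL hCSTrc hB hLZZ h821 h61 W p hr hcell
    hp5 hsurj htt hWan

end Kernel

end Summit.BirchSwinnertonDyer.BirchSwinnertonDyer.Theorems.WanAnyRoad

end
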